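import Literature.NumberTheory.GaloisRepresentations.IdeleClassInvariantCyclic
import Literature.NumberTheory.Automorphic.IdeleClassGroupCyclicLayerArtinClass
import Literature.NumberTheory.Automorphic.IdeleClassBaseChangeInjective
import Literature.NumberTheory.GaloisRepresentations.GlobalArtinMapAbstractExtensionProofs
import HarnessLib

/-!
# The invariants of the carry classes `[c_σ · ι(x)] ∈ H²(Gal(E/F), C_E)` of a CYCLIC layer as a character of
# the idèle group: kernel `Fˣ N_{E/F} 𝕀_E`, image `(1/n)ℤ/ℤ`, factorisation through the Artin map
# (Tate, C–F VII §11.3 — the frame; Serre, *Local Fields* XI §3)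

Topic `NumberTheory/GaloisRepresentations`; namespace `Literature.NumberTheory.GaloisRepresentations.IdeleCohomology`
(sequel to `IdeleClassInvariantCyclic`: `classInv F E : H²(Gal(E/F), C_E) →+ ℚ/ℤ`, injective, image
`(1/[E:F])ℤ/ℤ`, `fundamentalClass F E`).  Definitions with bodies (`baseInvariant`, `carryInv`,
`carryInvChar`) and theorems; NO named fact, no `sorry`, no instance, no notation; number fields in `Type`.

Let `E/F` be a cyclic extension of number fields, `G = Gal(E/F)` of order `n`, `σ` a generator.  The engine's
carry-class map `carryClassHom σ : C_E^G → H²(G, C_E)`, `a ↦ [c_σ · a] = a · δχ_σ`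
(`Literature.Algebra.Homology.FiniteCyclic.carryClassHom`, Serre VIII §4) is onto with kernel `N_G C_E`, and
`C_E^G = ι(C_F)` (Tate VII §8 Prop. 8.1).  Composing with the idèle base map `x ↦ ι[x]` and with `classInv`:

* §1 `baseInvariant x = ι[x] ∈ C_E^G` (`x` an idèle of `F`), additive, surjective onto `C_E^G`;
  **`coe_baseInvariant_mem_range_norm_iff : ι[x] ∈ N_G C_E ↔ x ∈ Fˣ N_{E/F} 𝕀_E`** (`classBaseChange` injective,
  `N_G C_E = ι(N_{E/F} C_E)`).
* §2 **`carryInv σ x := classInv [c_σ · ι[x]] ∈ ℚ/ℤ`**: additive in `x`, **kernel exactly the norm group**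
  (`carryInv_eq_zero_iff`), `n · carryInv = 0`, **image exactly `(1/n)ℤ/ℤ`** (`range_carryInv`).
* §3 factorisation through THE Artin map `ψ_{E/F} = artinIdeleMapOfAlgebra F E` of the tree's reciprocity law
  (`ker ψ = Fˣ N_{E/F} 𝕀_E`, Tate VII §5.1 (B)): **`carryInvChar σ : Gal(E/F) →* Multiplicative ℚ/ℤ`** with
  `carryInvChar σ (ψ x) = carryInv σ x` (`carryInvChar_artin`) and **`carryInvChar_injective`** — the values
  `classInv(ι[x] · δχ_σ)` are an INJECTIVE character of `ψ_{E/F}(x)`.  (That this character is `g ↦ -χ_σ(g)`,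
  i.e. Tate's §11.3 "the norm residue map of the class formation is the Artin map" on the nose, needs one
  local computation at an unramified place and is NOT in this file.)
* §4 the norm residue symbol of ANY fundamental class of the layer (in particular of THE canonical class
  `fundamentalClass F E`, `IdeleClassInvariantCyclic.exists_isClassModule_H2π_eq_fundamentalClass`):
  `(ι[x], E/F)_φ = 1 ↔ x ∈ Fˣ N 𝕀_E` and **`(ι[x], E/F)_φ = e(ψ_{E/F} x)` for an automorphism `e` of `G`**
  (`exists_mulEquiv_normResidueSymbol_baseInvariant_eq`) — Tate §11.3 up to `Aut G`.

HONEST FRAMING: classical global class field theory (Tate 1967) in the tree's normalisation; proves no case of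
BSD; written for Route A of crux `AnticycControlAdditiveK` (cell bsd-schneider, FINDING-door-c6-g12 §4 (iv)): it
carries door-c6 g11's `α¹(Γ_F, ℤ/m)` statements (for an `IsGlobalReciprocityMap`) to the class formation's own
cup-product pairing at cyclic layers, up to the unit pinned in the sequel.

## References
* J. W. S. Cassels, A. Fröhlich (eds.), *Algebraic Number Theory* (1967), Ch. VII (J. Tate) §8 Prop. 8.1,
  §5.1 Main Theorem (B), §11.2, §11.3. [CasselsFrohlichANT1967]
* J.-P. Serre, *Local Fields*, GTM 67 (1979), VIII §4 (the map `a ↦ a · θ_s`), XI §3 (the norm residue symbol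
  of a class formation). [SerreLocalFields1979]
* J. Neukirch, *Class Field Theory — The Bonn Lectures* (2013), Part II §1 Thm. (1.9) and the Nakayama map.
  [Neukirch2013]
-/

noncomputable section

open NumberField CategoryTheory groupCohomology Function
open Literature.NumberTheory.Automorphic

namespace Literature.NumberTheory.GaloisRepresentations

namespace IdeleCohomology

open Literature.Algebra.Homology IdeleClassGroup
open Literature.AnabelianGeometry.AbsoluteAnabelian.Prop121vii (zmodToQmodZ zmodToQmodZ_injective)

variable {F : Type} [Field F] [NumberField F] {E : Type} [Field E] [NumberField E] [Algebra F E] [IsGalois F E]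

/-! ## §1. The invariant class `ι[x] ∈ C_E^G` of an idèle of the base -/

/-- **`ι[x] ∈ C_E^{Gal(E/F)}`**: the idèle class of `E` of the base-changed idèle `x` of `F`, as an element of
the invariants of `galoisRep F E` (`IdeleClassGroup.ofMul_classBaseChange_mem_invariants`).
[cite: CasselsFrohlichANT1967, Ch. VII §8 Prop. 8.1] -/
def baseInvariant (x : ideleGroup F) : (galoisRep F E).ρ.invariants :=
  ⟨_, ofMul_classBaseChange_mem_invariants (E := E) x⟩

omit [IsGalois F E] in
/-- Unfolding: the underlying vector of `ι[x]` is `ofMul (classBaseChange [x])`.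
[cite: CasselsFrohlichANT1967, Ch. VII §8 Prop. 8.1] -/
theorem coe_baseInvariant (x : ideleGroup F) :
    ((baseInvariant (E := E) x : (galoisRep F E).ρ.invariants) : (galoisRep F E).V) =
      Additive.ofMul (classBaseChange F E (x : IdeleClassGroup F)) := rfl

omit [IsGalois F E] in
/-- `ι[1] = 0`. [cite: CasselsFrohlichANT1967, Ch. VII §8 Prop. 8.1] -/
theorem baseInvariant_one : baseInvariant (E := E) (1 : ideleGroup F) = 0 :=
  Subtype.ext (by rw [coe_baseInvariant, QuotientGroup.mk_one, map_one]; rfl)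

omit [IsGalois F E] in
/-- `ι[x y] = ι[x] + ι[y]`. [cite: CasselsFrohlichANT1967, Ch. VII §8 Prop. 8.1] -/
theorem baseInvariant_mul (x y : ideleGroup F) :
    baseInvariant (E := E) (x * y) = baseInvariant x + baseInvariant y :=
  Subtype.ext (by
    change Additive.ofMul (classBaseChange F E ((x * y : ideleGroup F) : IdeleClassGroup F)) =
      Additive.ofMul (classBaseChange F E (x : IdeleClassGroup F)) +
        Additive.ofMul (classBaseChange F E (y : IdeleClassGroup F))
    rw [QuotientGroup.mk_mul, map_mul]
    rfl)

omit [IsGalois F E] in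
/-- `ι[x ^ k] = k • ι[x]` (`k : ℤ`). [cite: CasselsFrohlichANT1967, Ch. VII §8 Prop. 8.1] -/
theorem baseInvariant_zpow (x : ideleGroup F) (k : ℤ) :
    baseInvariant (E := E) (x ^ k) = k • baseInvariant x :=
  -- `baseInvariant ∘ toMul` is an additive homomorphism
  (AddMonoidHom.mk' (fun y : Additive (ideleGroup F) => baseInvariant (E := E) (Additive.toMul y))
    (fun _ _ => baseInvariant_mul _ _)).map_zsmul k (Additive.ofMul x)

/-- **`baseInvariant` is onto `C_E^G`**: every invariant class is `ι[x]` for an idèle `x` of `F`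
(`C_E^G = ι(C_F)`, Tate VII §8 Prop. 8.1, and `𝕀_F ↠ C_F`). [cite: CasselsFrohlichANT1967, Ch. VII §8 Prop. 8.1] -/
theorem baseInvariant_surjective : Surjective (baseInvariant (F := F) (E := E)) := fun s => by
  obtain ⟨c, hc⟩ : Additive.toMul s.1 ∈ (classBaseChange F E).range :=
    (mem_range_classBaseChange_iff (F := F) _).2 ((mem_invariants_galoisRep s.1).1 s.2)
  obtain ⟨x, rfl⟩ := QuotientGroup.mk_surjective c
  exact ⟨x, Subtype.ext (by rw [coe_baseInvariant, hc]; rfl)⟩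

/-- **`ι[x] ∈ N_G C_E ↔ x ∈ Fˣ N_{E/F} 𝕀_E`**: the invariant class of `x` is a norm of the module `C_E` iff `x`
lies in the norm group (`⇐`: `IdeleClassGroup.classBaseChange_mem_range_norm_of_mem_normGroup`; `⇒`:
`N_G C_E = ι(N_{E/F} C_E)` and `ι : C_F → C_E` injective). [cite: CasselsFrohlichANT1967, Ch. VII §8 Prop. 8.1, §9 Thm. 9.1] -/
theorem coe_baseInvariant_mem_range_norm_iff (x : ideleGroup F) :
    ((baseInvariant (E := E) x : (galoisRep F E).ρ.invariants) : (galoisRep F E).V) ∈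
        LinearMap.range (galoisRep F E).ρ.norm ↔ x ∈ normGroup F E := by
  refine ⟨fun h => ?_, fun h => classBaseChange_mem_range_norm_of_mem_normGroup h⟩
  have h1 : Additive.ofMul (classBaseChange F E (x : IdeleClassGroup F)) ∈
      (LinearMap.range (galoisRep F E).ρ.norm).toAddSubgroup := h
  rw [toAddSubgroup_range_norm_galoisRep, range_classGalNorm_eq_map] at h1
  obtain ⟨c, ⟨d, rfl⟩, hc⟩ := h1
  have hcx : classRelNorm F E d = (x : IdeleClassGroup F) := classBaseChange_injective (K := F) (L := E) hc
  have hx : (x : IdeleClassGroup F) ∈ (classRelNorm F E).range := ⟨d, hcx⟩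
  rw [← map_normGroup_eq_range_classRelNorm] at hx
  obtain ⟨y, hy, hyx⟩ := hx
  rw [QuotientGroup.mk'_apply, QuotientGroup.eq] at hyx
  have : x = y * (y⁻¹ * x) := by rw [mul_inv_cancel_left]
  rw [this]
  exact (normGroup F E).mul_mem hy (principalIdeles_le_normGroup F E hyx)

/-! ## §2. The carry invariant `carryInv σ x = classInv [c_σ · ι[x]]` of a cyclic layer -/

variable [IsCyclic (E ≃ₐ[F] E)] (σ : E ≃ₐ[F] E) (hσ : ∀ g, g ∈ Subgroup.zpowers σ)

/-- **`carryInv σ x = classInv [c_σ · ι[x]] ∈ ℚ/ℤ`**: the invariant of the carry class (`= ι[x] · δχ_σ`, Serre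
VIII §4) of the invariant idèle class of `x`. [cite: CasselsFrohlichANT1967, Ch. VII §11.3][cite: SerreLocalFields1979, Ch. XI §3] -/
def carryInv (x : ideleGroup F) : AddCircle (1 : ℚ) :=
  classInv F E (FiniteCyclic.carryClassHom σ hσ (galoisRep F E) (baseInvariant x))

/-- Unfolding. [cite: CasselsFrohlichANT1967, Ch. VII §11.3] -/
theorem carryInv_apply (x : ideleGroup F) :
    carryInv σ hσ x = classInv F E (FiniteCyclic.carryClassHom σ hσ (galoisRep F E) (baseInvariant x)) := rfl

/-- `carryInv σ 1 = 0`. [cite: CasselsFrohlichANT1967, Ch. VII §11.3] -/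
theorem carryInv_one : carryInv (E := E) σ hσ 1 = 0 := by
  rw [carryInv_apply, baseInvariant_one, map_zero, map_zero]

/-- **Additivity**: `carryInv σ (x y) = carryInv σ x + carryInv σ y`. [cite: CasselsFrohlichANT1967, Ch. VII §11.3] -/
theorem carryInv_mul (x y : ideleGroup F) : carryInv (E := E) σ hσ (x * y) = carryInv σ hσ x + carryInv σ hσ y := by
  rw [carryInv_apply, baseInvariant_mul, map_add, map_add, carryInv_apply, carryInv_apply]

/-- `carryInv σ (x ^ k) = k • carryInv σ x`. [cite: CasselsFrohlichANT1967, Ch. VII §11.3] -/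
theorem carryInv_zpow (x : ideleGroup F) (k : ℤ) : carryInv (E := E) σ hσ (x ^ k) = k • carryInv σ hσ x := by
  rw [carryInv_apply, baseInvariant_zpow, map_zsmul, map_zsmul, carryInv_apply]

/-- **The carry invariant as a homomorphism `𝕀_F →* Multiplicative ℚ/ℤ`.** [cite: CasselsFrohlichANT1967, Ch. VII §11.3] -/
def carryInvHom : ideleGroup F →* Multiplicative (AddCircle (1 : ℚ)) where
  toFun x := Multiplicative.ofAdd (carryInv (E := E) σ hσ x)
  map_one' := by rw [carryInv_one, ofAdd_zero]
  map_mul' x y := by rw [carryInv_mul, ofAdd_add]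

/-- Unfolding. [cite: CasselsFrohlichANT1967, Ch. VII §11.3] -/
@[simp] theorem carryInvHom_apply (x : ideleGroup F) :
    carryInvHom (E := E) σ hσ x = Multiplicative.ofAdd (carryInv (E := E) σ hσ x) := rfl

/-- **Kernel = the norm group**: `carryInv σ x = 0 ↔ x ∈ Fˣ N_{E/F} 𝕀_E` (`classInv` injective, the kernel of
`a ↦ [c_σ · a]` is `N_G C_E`, §1). [cite: CasselsFrohlichANT1967, Ch. VII §11.3][cite: SerreLocalFields1979, Ch. VIII §4] -/
theorem carryInv_eq_zero_iff (x : ideleGroup F) : carryInv (E := E) σ hσ x = 0 ↔ x ∈ normGroup F E := by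
  rw [carryInv_apply, classInv_eq_zero_iff, FiniteCyclic.carryClassHom_eq_zero_iff,
    coe_baseInvariant_mem_range_norm_iff]

/-- `ker carryInvHom = Fˣ N_{E/F} 𝕀_E`. [cite: CasselsFrohlichANT1967, Ch. VII §11.3] -/
theorem ker_carryInvHom : (carryInvHom (E := E) σ hσ).ker = normGroup F E := by
  ext x
  rw [MonoidHom.mem_ker, carryInvHom_apply, ← ofAdd_zero, Multiplicative.ofAdd.injective.eq_iff,
    carryInv_eq_zero_iff]

/-- `n · carryInv σ x = 0`, `n = #Gal(E/F)`. [cite: CasselsFrohlichANT1967, Ch. VII §11.2] -/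
theorem natCard_nsmul_carryInv_eq_zero (x : ideleGroup F) :
    Nat.card (E ≃ₐ[F] E) • carryInv (E := E) σ hσ x = 0 :=
  natCard_nsmul_classInv_eq_zero _

/-- **The image of `carryInv σ` is exactly `(1/n)ℤ/ℤ`** (`a ↦ [c_σ · a]` is onto `H²`, `baseInvariant` onto
`C_E^G`, and `range classInv = (1/n)ℤ/ℤ`). [cite: CasselsFrohlichANT1967, Ch. VII §11.2–11.3] -/
theorem range_carryInv [NeZero (Nat.card (E ≃ₐ[F] E))] :
    Set.range (carryInv (E := E) σ hσ) = Set.range (zmodToQmodZ (Nat.card (E ≃ₐ[F] E))) := by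
  rw [← range_classInv (F := F) (E := E)]
  ext t
  constructor
  · rintro ⟨x, rfl⟩
    exact ⟨_, rfl⟩
  · rintro ⟨c, rfl⟩
    obtain ⟨a, ha⟩ := FiniteCyclic.carryClassHom_surjective σ hσ (galoisRep F E) c
    obtain ⟨x, rfl⟩ := baseInvariant_surjective a
    exact ⟨x, by rw [carryInv_apply, ha]⟩

/-- `carryInv σ` is onto `(1/n)ℤ/ℤ`: every `zmodToQmodZ n a` is a value. [cite: CasselsFrohlichANT1967, Ch. VII §11.2–11.3] -/
theorem exists_carryInv_eq [NeZero (Nat.card (E ≃ₐ[F] E))] (a : ZMod (Nat.card (E ≃ₐ[F] E))) :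
    ∃ x : ideleGroup F, carryInv (E := E) σ hσ x = zmodToQmodZ (Nat.card (E ≃ₐ[F] E)) a := by
  have h : zmodToQmodZ (Nat.card (E ≃ₐ[F] E)) a ∈ Set.range (carryInv (E := E) σ hσ) := by
    rw [range_carryInv]; exact ⟨a, rfl⟩
  exact h

/-! ## §3. Factorisation through the Artin map -/

/-- **`carryInv σ` is constant on the fibres of the Artin map** `ψ_{E/F} = artinIdeleMapOfAlgebra F E`
(`ψ x = ψ y ⇒ x y⁻¹ ∈ ker ψ = Fˣ N 𝕀_E = ker carryInv`). [cite: CasselsFrohlichANT1967, Ch. VII §5.1 Main Theorem (B), §11.3] -/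
theorem carryInv_eq_of_artin_eq {x y : ideleGroup F}
    (h : (haveI := IsAbelianGalois.of_isCyclic F E; artinIdeleMapOfAlgebra F E artinReciprocity_character_holds x) =
      (haveI := IsAbelianGalois.of_isCyclic F E; artinIdeleMapOfAlgebra F E artinReciprocity_character_holds y)) :
    carryInv (E := E) σ hσ x = carryInv σ hσ y := by
  haveI := IsAbelianGalois.of_isCyclic F E
  have hxy : x * y⁻¹ ∈ normGroup F E := by
    rw [← ker_artinIdeleMapOfAlgebra F E artinReciprocity_character_holds, MonoidHom.mem_ker, map_mul, map_inv, h,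
      mul_inv_cancel]
  have h0 := (carryInv_eq_zero_iff σ hσ (x * y⁻¹)).2 hxy
  rw [carryInv_mul, ← zpow_neg_one, carryInv_zpow, neg_one_zsmul, add_neg_eq_zero] at h0
  exact h0

/-- **The carry invariant as a character of `Gal(E/F)`**: the descent of `carryInvHom σ` along the (surjective)
Artin map `ψ_{E/F} : 𝕀_F ↠ Gal(E/F)` (Mathlib `MonoidHom.liftOfSurjective`).
[cite: CasselsFrohlichANT1967, Ch. VII §11.3][cite: SerreLocalFields1979, Ch. XI §3] -/
def carryInvChar : (E ≃ₐ[F] E) →* Multiplicative (AddCircle (1 : ℚ)) :=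
  haveI := IsAbelianGalois.of_isCyclic F E
  (artinIdeleMapOfAlgebra F E artinReciprocity_character_holds).liftOfSurjective
    (artinIdeleMapOfAlgebra_surjective F E _)
    ⟨carryInvHom (E := E) σ hσ, by
      rw [ker_artinIdeleMapOfAlgebra F E artinReciprocity_character_holds, ker_carryInvHom]⟩

/-- **`carryInvChar σ (ψ_{E/F} x) = carryInv σ x`.** [cite: CasselsFrohlichANT1967, Ch. VII §11.3] -/
theorem carryInvChar_artin (x : ideleGroup F) :
    carryInvChar (E := E) σ hσ
        (haveI := IsAbelianGalois.of_isCyclic F E; artinIdeleMapOfAlgebra F E artinReciprocity_character_holds x) =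
      Multiplicative.ofAdd (carryInv (E := E) σ hσ x) := by
  haveI := IsAbelianGalois.of_isCyclic F E
  exact (artinIdeleMapOfAlgebra F E artinReciprocity_character_holds).liftOfRightInverse_comp_apply _ _ _ x

/-- **`carryInvChar σ` is injective** (its image `(1/n)ℤ/ℤ` has `n = #Gal(E/F)` elements).
[cite: CasselsFrohlichANT1967, Ch. VII §11.3] -/
theorem carryInvChar_injective : Injective (carryInvChar (E := E) σ hσ) := by
  haveI := IsAbelianGalois.of_isCyclic F E
  haveI : NeZero (Nat.card (E ≃ₐ[F] E)) := ⟨Nat.card_pos.ne'⟩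
  set ψ := artinIdeleMapOfAlgebra F E artinReciprocity_character_holds with hψ
  -- the range of `carryInvChar` is `ofAdd '' (1/n)ℤ/ℤ`, of cardinality `n`
  have hrange : Set.range (carryInvChar (E := E) σ hσ) =
      Multiplicative.ofAdd '' Set.range (zmodToQmodZ (Nat.card (E ≃ₐ[F] E))) := by
    rw [← range_carryInv σ hσ]
    ext t
    constructor
    · rintro ⟨g, rfl⟩
      obtain ⟨x, hx⟩ := artinIdeleMapOfAlgebra_surjective F E artinReciprocity_character_holds g
      exact ⟨carryInv σ hσ x, ⟨x, rfl⟩, by rw [← hx]; exact (carryInvChar_artin σ hσ x).symm⟩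
    · rintro ⟨_, ⟨x, rfl⟩, rfl⟩
      exact ⟨ψ x, carryInvChar_artin σ hσ x⟩
  have hcard : Nat.card (Set.range (carryInvChar (E := E) σ hσ)) = Nat.card (E ≃ₐ[F] E) := by
    rw [hrange, Nat.card_image_of_injective Multiplicative.ofAdd.injective,
      Nat.card_range_of_injective (zmodToQmodZ_injective _), Nat.card_zmod]
  have hbij : Bijective (Set.rangeFactorization (carryInvChar (E := E) σ hσ)) :=
    (Nat.bijective_iff_surjective_and_card _).2 ⟨Set.rangeFactorization_surjective, hcard.symm⟩
  exact fun x y h => hbij.1 (Subtype.ext h)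

/-- `carryInvChar σ g = 1 ↔ g = 1`. [cite: CasselsFrohlichANT1967, Ch. VII §11.3] -/
theorem carryInvChar_eq_one_iff (g : E ≃ₐ[F] E) : carryInvChar (E := E) σ hσ g = 1 ↔ g = 1 :=
  ⟨fun h => carryInvChar_injective σ hσ (h.trans (map_one _).symm), fun h => by rw [h, map_one]⟩

/-- **`carryInv σ x = carryInv σ y ↔ ψ_{E/F} x = ψ_{E/F} y`.** [cite: CasselsFrohlichANT1967, Ch. VII §11.3] -/
theorem carryInv_eq_iff_artin_eq (x y : ideleGroup F) :
    carryInv (E := E) σ hσ x = carryInv σ hσ y ↔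
      (haveI := IsAbelianGalois.of_isCyclic F E; artinIdeleMapOfAlgebra F E artinReciprocity_character_holds x) =
        (haveI := IsAbelianGalois.of_isCyclic F E; artinIdeleMapOfAlgebra F E artinReciprocity_character_holds y) := by
  refine ⟨fun h => carryInvChar_injective σ hσ ?_, fun h => carryInv_eq_of_artin_eq σ hσ h⟩
  rw [carryInvChar_artin, carryInvChar_artin, h]

/-! ## §4. The norm residue symbol of a fundamental class on `ι[x]` -/

omit [IsCyclic (E ≃ₐ[F] E)] in
/-- **`(ι[x], E/F)_φ = 1 ↔ x ∈ Fˣ N_{E/F} 𝕀_E`** for EVERY fundamental class `φ` of the layer `(Gal(E/F), C_E)`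
(the kernel of the norm residue symbol is `N_G C_E`, §1). [cite: Neukirch2013, Part II §1 Thm. (1.9)][cite: CasselsFrohlichANT1967, Ch. VII §11.3] -/
theorem normResidueSymbol_baseInvariant_eq_one_iff {φ : cocycles₂ (galoisRep F E)}
    (hA : IsClassModule (galoisRep F E) φ) (x : ideleGroup F) :
    hA.normResidueSymbol (baseInvariant x) = 1 ↔ x ∈ normGroup F E := by
  rw [hA.normResidueSymbol_eq_one_iff, coe_baseInvariant_mem_range_norm_iff]

/-- **Tate §11.3 up to `Aut Gal(E/F)`**: for EVERY fundamental class `φ` of a CYCLIC layer `(Gal(E/F), C_E)` there is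
an automorphism `e` of `Gal(E/F)` with `(ι[x], E/F)_φ = e(ψ_{E/F} x)` in `Gal(E/F)^{ab}` for all idèles `x` of
`F` (both `x ↦ (ι[x], E/F)_φ` and `ψ_{E/F}` are onto a cyclic group of order `n` with kernel `Fˣ N 𝕀_E`).  For THE
canonical class (`classInv = 1/n`) the automorphism is the identity — the local computation of the sequel.
[cite: CasselsFrohlichANT1967, Ch. VII §11.3][cite: Neukirch2013, Part II §1 Thm. (1.9)] -/
theorem exists_mulEquiv_normResidueSymbol_baseInvariant_eq {φ : cocycles₂ (galoisRep F E)}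
    (hA : IsClassModule (galoisRep F E) φ) :
    ∃ e : (E ≃ₐ[F] E) ≃* (E ≃ₐ[F] E), ∀ x : ideleGroup F,
      hA.normResidueSymbol (baseInvariant x) =
        Abelianization.of (e (haveI := IsAbelianGalois.of_isCyclic F E;
          artinIdeleMapOfAlgebra F E artinReciprocity_character_holds x)) := by
  haveI := IsAbelianGalois.of_isCyclic F E
  obtain ⟨σ, hσ⟩ := IsCyclic.exists_generator (α := E ≃ₐ[F] E)
  set ψ := artinIdeleMapOfAlgebra F E artinReciprocity_character_holds with hψ
  -- a generator of the symbol side: `Σ_τ φ(τ, σ) = ι[x₀]`, `(ι[x₀], E/F) = σ̄⁻¹`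
  obtain ⟨x₀, hx₀⟩ := baseInvariant_surjective (F := F) (E := E) (Nakayama.nakayamaSum φ σ)
  have hsymb₀ : hA.normResidueSymbol (baseInvariant x₀) = (Abelianization.of σ)⁻¹ := by
    rw [hx₀, hA.normResidueSymbol_nakayamaSum]
  -- `ψ x₀` generates `Gal(E/F)`: the symbol of `ι[x₀ ^ k]` is `σ̄^{-k}`, trivial iff `n ∣ k`, iff `x₀ ^ k ∈ ker ψ`
  set g₀ := ψ x₀ with hg₀
  have hsymb_pow : ∀ k : ℤ, hA.normResidueSymbol (baseInvariant (E := E) (x₀ ^ k)) = (Abelianization.of σ)⁻¹ ^ k := by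
    intro k
    have h := map_zsmul hA.normResidueHom k (baseInvariant (E := E) x₀)
    rw [← baseInvariant_zpow, IsClassModule.normResidueHom_apply, IsClassModule.normResidueHom_apply, hsymb₀] at h
    exact congrArg Additive.toMul h
  have horder : ∀ k : ℤ, g₀ ^ k = 1 ↔ σ ^ k = 1 := by
    intro k
    rw [hg₀, ← map_zpow, ← MonoidHom.mem_ker, ker_artinIdeleMapOfAlgebra F E artinReciprocity_character_holds,
      ← normResidueSymbol_baseInvariant_eq_one_iff hA, hsymb_pow, inv_zpow', zpow_neg, inv_eq_one]
    constructor
    · intro h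
      -- `σ̄ ^ k = 1` in `G^{ab}` with `G` commutative ⇒ `σ ^ k = 1`
      have hinj : Function.Injective (Abelianization.of : (E ≃ₐ[F] E) → Abelianization (E ≃ₐ[F] E)) := by
        intro a b hab
        have := (QuotientGroup.eq (s := commutator (E ≃ₐ[F] E))).1 hab
        rw [commutator_eq_bot, Subgroup.mem_bot, inv_mul_eq_one] at this
        exact this
      exact hinj (by rw [map_zpow, h, map_one])
    · intro h
      rw [← map_zpow, h, map_one]
  have hgen : ∀ g : E ≃ₐ[F] E, g ∈ Subgroup.zpowers g₀ := by
    have hord : orderOf g₀ = orderOf σ := by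
      apply Nat.dvd_antisymm
      · exact orderOf_dvd_iff_pow_eq_one.2 (by
          have h := (horder (orderOf σ)).2 (by rw [zpow_natCast, pow_orderOf_eq_one])
          rwa [zpow_natCast] at h)
      · exact orderOf_dvd_iff_pow_eq_one.2 (by
          have h := (horder (orderOf g₀)).1 (by rw [zpow_natCast, pow_orderOf_eq_one])
          rwa [zpow_natCast] at h)
    have hcard : orderOf g₀ = Nat.card (E ≃ₐ[F] E) := by
      rw [hord, ← Nat.card_zpowers, (Subgroup.eq_top_iff' _).2 hσ, Subgroup.card_top]
    have htop : Subgroup.zpowers g₀ = ⊤ := by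
      apply Subgroup.eq_top_of_card_eq
      rw [Nat.card_zpowers, hcard]
    intro g
    rw [htop]
    exact Subgroup.mem_top g
  -- the automorphism `g₀ ↦ σ⁻¹` of the cyclic group
  have hordeq : orderOf σ⁻¹ = orderOf g₀ := by
    rw [orderOf_inv]
    apply Nat.dvd_antisymm
    · exact orderOf_dvd_iff_pow_eq_one.2 (by
        have h := (horder (orderOf g₀)).1 (by rw [zpow_natCast, pow_orderOf_eq_one])
        rwa [zpow_natCast] at h)
    · exact orderOf_dvd_iff_pow_eq_one.2 (by
        have h := (horder (orderOf σ)).2 (by rw [zpow_natCast, pow_orderOf_eq_one])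
        rwa [zpow_natCast] at h)
  obtain ⟨e, he⟩ : ∃ e : (E ≃ₐ[F] E) ≃* (E ≃ₐ[F] E), e g₀ = σ⁻¹ := by
    have hσ'' : ∀ g : E ≃ₐ[F] E, g ∈ Subgroup.zpowers σ⁻¹ := fun g => by rw [Subgroup.zpowers_inv]; exact hσ g
    refine ⟨mulEquivOfOrderOfEq (g := g₀) (g' := σ⁻¹) hgen hσ'' hordeq.symm, ?_⟩
    exact mulEquivOfOrderOfEq_apply_gen hgen hσ'' hordeq.symm
  refine ⟨e, fun x => ?_⟩
  obtain ⟨k, hk⟩ := Subgroup.mem_zpowers_iff.1 (hgen (ψ x))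
  -- `x = x₀ ^ k · m` with `m ∈ ker ψ = Fˣ N 𝕀_E`
  have hm : (x₀ ^ k)⁻¹ * x ∈ normGroup F E := by
    rw [← ker_artinIdeleMapOfAlgebra F E artinReciprocity_character_holds, MonoidHom.mem_ker, map_mul, map_inv,
      map_zpow, ← hg₀, hk, inv_mul_cancel]
  have hx : x = x₀ ^ k * ((x₀ ^ k)⁻¹ * x) := by rw [mul_inv_cancel_left]
  have hm1 : hA.normResidueSymbol (baseInvariant (E := E) ((x₀ ^ k)⁻¹ * x)) = 1 :=
    (normResidueSymbol_baseInvariant_eq_one_iff hA _).2 hm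
  rw [hx, baseInvariant_mul, hA.normResidueSymbol_add, hm1, mul_one, hsymb_pow, map_mul,
    (MonoidHom.mem_ker.1 (by rw [ker_artinIdeleMapOfAlgebra F E artinReciprocity_character_holds]; exact hm) :
      ψ ((x₀ ^ k)⁻¹ * x) = 1), mul_one, map_zpow, ← hg₀, map_zpow, he, map_zpow, map_inv]

end IdeleCohomology

end Literature.NumberTheory.GaloisRepresentations

end
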